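import Summits.ValiantsHypothesis.ValiantsHypothesis.Theorems.LSTPipelinePer
import Literature.Computability.AlgebraicComplexity.ArithCircuitProjections
import Mathlib.Algebra.MvPolynomial.Monad
import HarnessLib

/-!
# The LST pipeline is quasi-polynomially capped through every projection
Route `Depth4`, `decomp-valiant` lens 4 «depth-reduction / chasm axis», gen 27 (OFFER O20), `--supports` item 11333
(`Depth4HomFour`).  Sorry-free; ONE certificate-shape `def : Prop` (assumed nowhere), no Literature fact.  CURRENCY = the
tree's typed LST engine (`Lam`, `Phi`, `stepConst`, `10 d ≤ k`) via the direct class `LSTCertifies` (p808751) and the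
projections `ArithCircuit.substVC`.  §1 `TLSTCertifies F s Δ` := SOME projection `A : σ₀ → Fin M ⊕ K`, SOME block map, a
direct certificate for `F(A)` (the shape of `perHardConstDepth`); soundness = the engine on `P.substVC A`.  §2 RANK CAP
`relrk(g(F')) ≤ |vars F'|^d · 2^{-L/2}` (`L = Σ_b |w_b|`) for EVERY block-preserving `g` (set-multilinear projection
commutes with `g`; `≤ C(|vars|, d)` surviving monomials, each a product of block-linear forms; sub-additivity).  §3
NUMERICS ⇒ `(s+1)^{36} < 2^{(⌊log₂N⌋+2)^2}`.  §4 THE CAP `not_tlstCertifies` (every target, `Δ ≥ 1`, field); §5 no depth-4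
chasm door `(m+2)^{c⌊√m⌋+c}`, `c ≥ 1`, for `per_m`, `det_m`.  GRADE: a ceiling of the TYPED ENGINE's constants — KNOWN in
spirit (LST's word constraint; BDS 2024 Thm 3 / EGOW = the print method-barriers), kernel-new as a projection-closed cap;
non-vacuity for `per_m` (LST Lemma 15 + `IMM ≤_p per`) on paper only.  Nothing here bears on `VP ≠ VNP`.
-/

set_option linter.dupNamespace false

namespace Summit.ValiantsHypothesis.ValiantsHypothesis.Theorems.LSTTransportCap
open MvPolynomial Finsupp Literature.Computability.AlgebraicComplexity
open Literature.Computability.AlgebraicComplexity.LSTWord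
open Summit.ValiantsHypothesis.ValiantsHypothesis.Theorems.LSTPipelinePer
noncomputable section
variable {K : Type*} [Field K]

/-- **Transported LST certificate** for `size > s` vs product-depth-`Δ` circuits for `F`: a projection `A` (variables
to variables or constants), a block map, a direct certificate for `F(A)`.  A certificate SHAPE. [cite: LimayeSrinivasanTavenas2025, Lemma 15] -/
def TLSTCertifies {σ₀ : Type} [Fintype σ₀] (F : MvPolynomial σ₀ K) (s Δ : ℕ) : Prop :=
  ∃ (M d : ℕ) (blk : Fin M → Fin d) (A : σ₀ → Fin M ⊕ K),
    LSTCertifies blk (aeval (ArithCircuit.substVCFun A) F) s Δ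

/-- A direct certificate has `d ≥ 1` (`d = 0`: `Φ = 1`, `relrk ≤ 1 ≤ Λ`). [cite: LimayeSrinivasanTavenas2025, Lemma 15] -/
theorem one_le_of_lstCertifies {σ₀ : Type} [Fintype σ₀] {d : ℕ} {blk₀ : σ₀ → Fin d}
    {F : MvPolynomial σ₀ K} {s Δ : ℕ} (h : LSTCertifies blk₀ F s Δ) : 1 ≤ d := by
  obtain ⟨k, pos, _, -, -, hlt⟩ := h
  refine Nat.one_le_iff_ne_zero.2 fun hd => ?_; subst hd
  rw [show Phi k Δ (0 : ℕ) = 1 by rw [Phi, Nat.cast_zero, Real.zero_rpow (mu_pos Δ).ne', mul_zero, zero_div,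
    Real.rpow_zero], mul_one] at hlt
  exact (not_le.2 hlt) ((relRank_le_one pos _ _).trans (one_le_Lam _ _ _ _))

/-- The direct class is the identity projection of the transported one. [cite: LimayeSrinivasanTavenas2025, Lemma 15] -/
theorem tlstCertifies_of_lstCertifies {σ₀ : Type} [Fintype σ₀] {d : ℕ} {blk₀ : σ₀ → Fin d}
    {F : MvPolynomial σ₀ K} {s Δ : ℕ} (h : LSTCertifies blk₀ F s Δ) : TLSTCertifies F s Δ := by
  obtain ⟨k, pos, g, hk, hg, hlt⟩ := h
  set e := Fintype.equivFin σ₀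
  have hfun : (fun v => aeval (g ∘ e.symm)
      (ArithCircuit.substVCFun (fun v => (Sum.inl (e v) : Fin (Fintype.card σ₀) ⊕ K)) v)) = g := by
    funext v; simp [ArithCircuit.substVCFun]
  refine ⟨_, d, blk₀ ∘ e.symm, fun v => (Sum.inl (e v) : Fin (Fintype.card σ₀) ⊕ K), k, pos, g ∘ e.symm, hk,
    fun t => hg (e.symm t), ?_⟩
  rw [show aeval (g ∘ e.symm) (aeval (ArithCircuit.substVCFun fun v => (Sum.inl (e v) : Fin (Fintype.card σ₀) ⊕ K)) F)
      = aeval g F by rw [← AlgHom.comp_apply, MvPolynomial.comp_aeval, hfun], Fintype.card_fin]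
  exact hlt

/-- **Soundness through a projection**: the engine on `P.substVC A`. [cite: LimayeSrinivasanTavenas2025, Lemma 15] -/
theorem size_lt_of_lstCertifies_projection [CharZero K] {σ₀ : Type} [Fintype σ₀] {τ : Type} [Fintype τ]
    {d : ℕ} {blk : τ → Fin d} {F : MvPolynomial σ₀ K} {A : σ₀ → τ ⊕ K} {s Δ : ℕ}
    (h : LSTCertifies blk (aeval (ArithCircuit.substVCFun A) F) s Δ) (P : ArithCircuit K σ₀)
    (hP : P.eval = F) (hΔ : P.productDepth ≤ Δ) : s < P.size := by
  have h1 := size_lt_of_lstCertifies (one_le_of_lstCertifies h) h (P.substVC A)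
    (by rw [ArithCircuit.eval_substVC, hP]) (by rw [ArithCircuit.productDepth_substVC]; exact hΔ)
  rwa [ArithCircuit.size_substVC] at h1

/-- **Soundness**: a transported certificate at `s` excludes size `≤ s` (char. `0`). [cite: LimayeSrinivasanTavenas2025, Lemma 15] -/
theorem size_lt_of_tlstCertifies [CharZero K] {σ₀ : Type} [Fintype σ₀] {F : MvPolynomial σ₀ K} {s Δ : ℕ}
    (h : TLSTCertifies F s Δ) (P : ArithCircuit K σ₀) (hP : P.eval = F) (hΔ : P.productDepth ≤ Δ) :
    s < P.size :=
  let ⟨_, _, _, _, h⟩ := h; size_lt_of_lstCertifies_projection h P hP hΔ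

section Cap
variable {d k : ℕ} {pos : Fin d → Bool} {τ : Type} {blk : τ → Fin d}
  {g : τ → MvPolynomial (Σ i : Fin d, BlockVar k pos i) K}

/-- `relrk(∏_i g(e i)) ≤ 2^{-(Σ_b |w_b|)/2}` for EVERY block pattern (else `0`). [cite: LimayeSrinivasanTavenas2025, Claim 7] -/
theorem relRank_prod_le (hg : IsBlockPreserving blk Sigma.fst g) {ι' : Type} [Fintype ι'] (e : ι' → τ) :
    relRank K pos Finset.univ (∏ i, g (e i)) ≤ (2 : ℝ) ^ (-((∑ b : Fin d, letterSize k pos b : ℕ) : ℝ) / 2) := by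
  by_cases hb : Function.Bijective fun i => blk (e i)
  exacts [relRank_prod_le_of_bijective hg e hb, (relRank_prod_eq_zero_of_not_bijective hg e hb).trans_le (by positivity)]

/-- One monomial: `g(c X^β)` is a scalar times a product of block-linear forms. [cite: LimayeSrinivasanTavenas2025, Claim 7] -/
theorem relRank_aeval_monomial_le (hg : IsBlockPreserving blk Sigma.fst g) (β : τ →₀ ℕ) (c : K) :
    relRank K pos Finset.univ (aeval g (monomial β c)) ≤
      (2 : ℝ) ^ (-((∑ b : Fin d, letterSize k pos b : ℕ) : ℝ) / 2) := by
  classical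
  have hprod : (β.prod fun t n => g t ^ n) = ∏ i : (Σ t : β.support, Fin (β (t : τ))), g (i.1 : τ) := by
    rw [Fintype.prod_sigma]; try dsimp only
    rw [Finsupp.prod, ← Finset.prod_coe_sort β.support (fun t => g t ^ β t)]
    exact Finset.prod_congr rfl fun t _ => by rw [Finset.prod_const, Finset.card_univ, Fintype.card_fin]
  rw [MvPolynomial.aeval_monomial, MvPolynomial.algebraMap_eq, ← MvPolynomial.smul_eq_C_mul, hprod]
  exact (relRank_smul_le pos Finset.univ c _).trans
    (relRank_prod_le hg fun i : (Σ t : β.support, Fin (β (t : τ))) => (i.1 : τ))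

/-- A monomial of block profile `1_{[d]}` is multilinear with exactly `d` variables. [folklore] -/
theorem le_one_and_card_support_eq (blk : τ → Fin d) {β : τ →₀ ℕ}
    (h : weight (blockWeight blk) β = blockProfile (Finset.univ : Finset (Fin d))) :
    (∀ t, β t ≤ 1) ∧ β.support.card = d := by
  have h1 : ∀ t, β t ≤ 1 := fun t => by
    simpa [h, blockProfile_apply] using apply_le_weight_blockWeight blk β t
  refine ⟨h1, ?_⟩
  have key : (Finsupp.mapDomain blk β).sum (fun _ n => n) = β.sum fun _ n => n :=
    Finsupp.sum_mapDomain_index (h := fun (_ : Fin d) (n : ℕ) => n) (fun _ => rfl) fun _ _ _ => rfl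
  rw [← weight_blockWeight_eq_mapDomain, h] at key
  simp only [Finsupp.sum, support_blockProfile, blockProfile_apply, Finset.mem_univ, if_true,
    Finset.sum_const, Finset.card_univ, Fintype.card_fin, smul_eq_mul, mul_one] at key
  rw [key, Finset.card_eq_sum_ones]
  exact Finset.sum_congr rfl fun t ht =>
    le_antisymm (Nat.one_le_iff_ne_zero.2 (Finsupp.mem_support_iff.1 ht)) (h1 t)

/-- The set-multilinear part of `F'` over all blocks has `≤ C(|vars F'|, d) ≤ |vars F'|^d` monomials. [folklore] -/
theorem card_support_smlProj_le (blk : τ → Fin d) (F' : MvPolynomial τ K) :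
    (smlProj blk (Finset.univ : Finset (Fin d)) F').support.card ≤ F'.vars.card ^ d := by
  classical
  have hmem : ∀ β ∈ (smlProj blk (Finset.univ : Finset (Fin d)) F').support,
      weight (blockWeight blk) β = blockProfile (Finset.univ : Finset (Fin d)) ∧ β ∈ F'.support := fun β hβ => by
    rw [MvPolynomial.mem_support_iff, coeff_smlProj] at hβ
    split_ifs at hβ with hw
    exacts [⟨hw, MvPolynomial.mem_support_iff.2 hβ⟩, absurd rfl hβ]
  have hmaps : Set.MapsTo (fun β : τ →₀ ℕ => β.support)
      ↑(smlProj blk (Finset.univ : Finset (Fin d)) F').support ↑(F'.vars.powersetCard d) := by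
    intro β hβ
    rw [Finset.mem_coe, Finset.mem_powersetCard]
    exact ⟨fun t ht => (MvPolynomial.mem_vars_iff_mem_support t).2 ⟨β, (hmem β hβ).2, ht⟩,
      (le_one_and_card_support_eq blk (hmem β hβ).1).2⟩
  have hinj : Set.InjOn (fun β : τ →₀ ℕ => β.support) ↑(smlProj blk (Finset.univ : Finset (Fin d)) F').support := by
    intro β₁ h₁ β₂ h₂ heq
    have l₁ := (le_one_and_card_support_eq blk (hmem β₁ h₁).1).1
    have l₂ := (le_one_and_card_support_eq blk (hmem β₂ h₂).1).1
    ext t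
    have ht := Finset.ext_iff.1 (show β₁.support = β₂.support from heq) t
    rw [Finsupp.mem_support_iff, Finsupp.mem_support_iff] at ht
    have l₁ := l₁ t; have l₂ := l₂ t; omega
  have hch := Nat.descFactorial_le_pow F'.vars.card d
  rw [Nat.descFactorial_eq_factorial_mul_choose] at hch
  calc (smlProj blk (Finset.univ : Finset (Fin d)) F').support.card
      ≤ (F'.vars.powersetCard d).card := Finset.card_le_card_of_injOn _ hmaps hinj
    _ ≤ F'.vars.card ^ d := by
        rw [Finset.card_powersetCard]; exact (Nat.le_mul_of_pos_left _ (Nat.factorial_pos d)).trans hch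

/-- **Rank cap** `relrk(g(F')) ≤ |vars F'|^d · 2^{-(Σ_b |w_b|)/2}`, every block-preserving `g`. [cite: LimayeSrinivasanTavenas2025, Claim 7] -/
theorem relRank_aeval_le_pow (hg : IsBlockPreserving blk Sigma.fst g) (F' : MvPolynomial τ K) :
    relRank K pos Finset.univ (aeval g F') ≤
      (F'.vars.card : ℝ) ^ d * (2 : ℝ) ^ (-((∑ b : Fin d, letterSize k pos b : ℕ) : ℝ) / 2) := by
  classical
  have hcard := card_support_smlProj_le blk F'
  rw [← relRank_smlProj pos Finset.univ (aeval g F'), hg.smlProj_aeval Finset.univ F']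
  set G := smlProj blk (Finset.univ : Finset (Fin d)) F'
  have haeval : aeval g G = ∑ β ∈ G.support, coeff β G • aeval g (monomial β (1 : K)) := by
    conv_lhs => rw [G.as_sum, map_sum]
    exact Finset.sum_congr rfl fun β _ => by simp only [MvPolynomial.aeval_monomial, map_one,
      one_mul, MvPolynomial.algebraMap_eq, MvPolynomial.smul_eq_C_mul]
  rw [haeval]
  calc relRank K pos Finset.univ (∑ β ∈ G.support, coeff β G • aeval g (monomial β (1 : K)))
      ≤ ∑ β ∈ G.support, relRank K pos Finset.univ (aeval g (monomial β (1 : K))) :=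
        relRank_sum_smul_le pos G.support Finset.univ (fun β => coeff β G) fun β => aeval g (monomial β (1 : K))
    _ ≤ (G.support.card : ℝ) * (2 : ℝ) ^ (-((∑ b : Fin d, letterSize k pos b : ℕ) : ℝ) / 2) :=
        (Finset.sum_le_sum fun β _ => relRank_aeval_monomial_le hg β 1).trans_eq
          (by rw [Finset.sum_const, nsmul_eq_mul])
    _ ≤ (F'.vars.card : ℝ) ^ d * (2 : ℝ) ^ (-((∑ b : Fin d, letterSize k pos b : ℕ) : ℝ) / 2) :=
        mul_le_mul_of_nonneg_right (by exact_mod_cast hcard) (by positivity)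

end Cap

/-- A projection does not increase the number of variables: `|vars F(A)| ≤ |σ₀|`. [folklore] -/
theorem card_vars_aeval_substVCFun_le {σ₀ : Type} [Fintype σ₀] {τ : Type} (A : σ₀ → τ ⊕ K)
    (F : MvPolynomial σ₀ K) : (aeval (ArithCircuit.substVCFun A) F).vars.card ≤ Fintype.card σ₀ := by
  classical
  have h1 : ∀ v, (ArithCircuit.substVCFun A v).vars.card ≤ 1 := fun v => by
    simp only [ArithCircuit.substVCFun]; cases A v <;> simp only [Sum.elim_inl, Sum.elim_inr,
      MvPolynomial.vars_X, MvPolynomial.vars_C, Finset.card_singleton, Finset.card_empty, le_refl, Nat.zero_le]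
  calc (aeval (ArithCircuit.substVCFun A) F).vars.card
      ≤ ∑ v ∈ F.vars, (ArithCircuit.substVCFun A v).vars.card := by
        rw [MvPolynomial.aeval_eq_bind₁]
        exact (Finset.card_le_card (MvPolynomial.vars_bind₁ _ _)).trans Finset.card_biUnion_le
    _ ≤ ∑ v ∈ F.vars, 1 := Finset.sum_le_sum fun v _ => h1 v
    _ = F.vars.card := (Finset.card_eq_sum_ones _).symm
    _ ≤ Fintype.card σ₀ := Finset.card_le_univ _

/-- NUMERICS, rank side: `32 N^{10} ≤ 2^{3k}`, `1 ≤ d` ⇒ `N^d · 2^{-(Σ_b|w_b|)/2} ≤ Φ_Δ(d)` (any `k`). [folklore] -/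
theorem pow_mul_two_pow_le_Phi {d k : ℕ} (pos : Fin d → Bool) (hd : 1 ≤ d) {N : ℕ} (hN : 32 * N ^ 10 ≤ 2 ^ (3 * k))
    (Δ : ℕ) :
    (N : ℝ) ^ d * (2 : ℝ) ^ (-((∑ b : Fin d, letterSize k pos b : ℕ) : ℝ) / 2) ≤ Phi k Δ d := by
  have hsum : d * posLetter k ≤ ∑ b : Fin d, letterSize k pos b :=
    calc d * posLetter k = ∑ _b : Fin d, posLetter k := by
          rw [Finset.sum_const, Finset.card_univ, Fintype.card_fin, smul_eq_mul]
      _ ≤ ∑ b, letterSize k pos b := Finset.sum_le_sum fun b _ => by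
          unfold letterSize; split_ifs; exacts [le_rfl, posLetter_le k]
  generalize (∑ b : Fin d, letterSize k pos b) = L at hsum ⊢
  have hk0 : (0 : ℝ) ≤ k := Nat.cast_nonneg k
  have hP : (7 / 10 : ℝ) * k ≤ k / Real.sqrt 2 := by
    rw [le_div_iff₀ sqrt_two_pos]
    nlinarith [mul_le_mul_of_nonneg_left ((Real.sqrt_le_left (by norm_num)).2 (by norm_num) : Real.sqrt 2 ≤ 10 / 7) hk0]
  have hL : (d : ℝ) * ((7 / 10 : ℝ) * k - 1) ≤ L := (mul_le_mul_of_nonneg_left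
    (by linarith [sub_one_lt_posLetter k] : (7 / 10 : ℝ) * k - 1 ≤ (posLetter k : ℝ)) (Nat.cast_nonneg _)).trans
    (by exact_mod_cast hsum)
  have h3 : (k : ℝ) * (d : ℝ) ^ mu Δ ≤ k * d := mul_le_mul_of_nonneg_left
    ((Real.rpow_le_rpow_of_exponent_le (by exact_mod_cast hd : (1 : ℝ) ≤ d) (mu_le_one Δ)).trans_eq (Real.rpow_one _)) hk0
  have hNx : (N : ℝ) ≤ (2 : ℝ) ^ (((3 : ℝ) * k - 5) / 10) := by
    refine le_of_pow_le_pow_left₀ (by norm_num : (10 : ℕ) ≠ 0) (by positivity) ?_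
    have h32 : ((2 : ℝ) ^ (((3 : ℝ) * k - 5) / 10)) ^ (10 : ℕ) = (2 : ℝ) ^ (3 * k) / 32 := by
      rw [← Real.rpow_natCast _ 10, ← Real.rpow_mul (by norm_num : (0 : ℝ) ≤ 2),
        show ((3 : ℝ) * k - 5) / 10 * ((10 : ℕ) : ℝ) = ((3 * k : ℕ) : ℝ) - ((5 : ℕ) : ℝ) by push_cast; ring,
        Real.rpow_sub (by norm_num : (0 : ℝ) < 2), Real.rpow_natCast, Real.rpow_natCast]
      norm_num
    have h32N : ((32 * N ^ 10 : ℕ) : ℝ) ≤ ((2 ^ (3 * k) : ℕ) : ℝ) := by exact_mod_cast hN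
    push_cast at h32N
    rw [h32, le_div_iff₀ (by norm_num : (0 : ℝ) < 32)]
    linarith
  calc (N : ℝ) ^ d * (2 : ℝ) ^ (-(L : ℝ) / 2)
      ≤ ((2 : ℝ) ^ (((3 : ℝ) * k - 5) / 10)) ^ d * (2 : ℝ) ^ (-(L : ℝ) / 2) :=
        mul_le_mul_of_nonneg_right (pow_le_pow_left₀ (Nat.cast_nonneg N) hNx d) (by positivity)
    _ = (2 : ℝ) ^ (((3 : ℝ) * k - 5) / 10 * d + -(L : ℝ) / 2) := by
        rw [← Real.rpow_natCast _ d, ← Real.rpow_mul (by norm_num : (0 : ℝ) ≤ 2), Real.rpow_add two_pos]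
    _ ≤ (2 : ℝ) ^ (-(k : ℝ) * (d : ℝ) ^ mu Δ / 20) := Real.rpow_le_rpow_of_exponent_le (by norm_num) (by linarith)
    _ = Phi k Δ d := by rw [Phi]

/-- NUMERICS, size side: `Λ Φ < r ≤ 1`, `d, Δ ≥ 1` ⇒ `(s+1)^{40} < 2^{kd}` (`Lam_eq`, `mu_le_one`). [folklore] -/
theorem pow_lt_two_pow_of_lt {M d k s Δ : ℕ} (hd : 1 ≤ d) (hΔ : 1 ≤ Δ) {r : ℝ} (hr : r ≤ 1)
    (hlt : Lam s M d Δ * Phi k Δ d < r) : (s + 1) ^ 40 < 2 ^ (k * d) := by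
  have hsc : (s + 1) ^ 2 ≤ stepConst s M d := by
    have h3 := Nat.mul_le_mul (Nat.mul_le_mul_left (s + 1) (by omega : s + 1 ≤ s + M + 1))
      (Nat.one_le_pow (5 * d + 1) (d + 1) (Nat.succ_pos d))
    rw [mul_one, ← sq] at h3; unfold stepConst; omega
  have hscR : ((s : ℝ) + 1) ^ 2 ≤ (stepConst s M d : ℝ) := by exact_mod_cast hsc
  have hsc1 : (1 : ℝ) ≤ (stepConst s M d : ℝ) :=
    (one_le_pow₀ (by linarith [Nat.cast_nonneg (α := ℝ) s] : (1 : ℝ) ≤ (s : ℝ) + 1)).trans hscR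
  have hΛ : ((s : ℝ) + 1) ^ 2 ≤ Lam s M d Δ := by
    rw [Lam_eq, ← mul_one (((s : ℝ) + 1) ^ 2)]
    exact mul_le_mul (hscR.trans (le_self_pow₀ hsc1 (by omega))) (by linarith [Nat.cast_nonneg (α := ℝ) M])
      zero_le_one (by positivity)
  have h3 : (k : ℝ) * (d : ℝ) ^ mu Δ ≤ k * d := mul_le_mul_of_nonneg_left
    ((Real.rpow_le_rpow_of_exponent_le (by exact_mod_cast hd : (1 : ℝ) ≤ d) (mu_le_one Δ)).trans_eq (Real.rpow_one _))
    (Nat.cast_nonneg k)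
  have hΦ : (2 : ℝ) ^ (-((k : ℝ) * d / 20)) ≤ Phi k Δ d := by
    rw [Phi]; exact Real.rpow_le_rpow_of_exponent_le (by norm_num) (by linarith)
  have hpos' : (0 : ℝ) < (2 : ℝ) ^ ((k : ℝ) * d / 20) := by positivity
  have h1 : ((s : ℝ) + 1) ^ 2 * (2 : ℝ) ^ (-((k : ℝ) * d / 20)) < 1 :=
    (mul_le_mul hΛ hΦ (by positivity) (zero_le_one.trans (one_le_Lam s M d Δ))).trans_lt (hlt.trans_le hr)
  rw [Real.rpow_neg (by norm_num : (0 : ℝ) ≤ 2), ← div_eq_mul_inv, div_lt_one hpos'] at h1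
  have h40 : (((s : ℝ) + 1) ^ 2) ^ 20 < ((2 : ℝ) ^ ((k : ℝ) * d / 20)) ^ 20 :=
    pow_lt_pow_left₀ h1 (by positivity) (by norm_num)
  rw [← pow_mul, show 2 * 20 = 40 from rfl, ← Real.rpow_natCast ((2 : ℝ) ^ ((k : ℝ) * d / 20)) 20,
    ← Real.rpow_mul (by norm_num : (0 : ℝ) ≤ 2),
    show (k : ℝ) * d / 20 * ((20 : ℕ) : ℝ) = ((k * d : ℕ) : ℝ) by push_cast; ring, Real.rpow_natCast] at h40
  exact_mod_cast h40

/-- NUMERICS: `3k ≤ 10ℓ+14`, `90 k d ≤ (10ℓ+14)^2 ≤ 100 (ℓ+2)^2` (`ℓ = ⌊log₂N⌋`). [folklore] -/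
theorem cap_arith {N k d s : ℕ} (hk : 10 * d ≤ k) (h3 : 2 ^ (3 * k) < 32 * N ^ 10)
    (h40 : (s + 1) ^ 40 < 2 ^ (k * d)) : (s + 1) ^ 36 < 2 ^ ((Nat.log 2 N + 2) ^ 2) := by
  have hN : N < 2 ^ (Nat.log 2 N + 1) := Nat.lt_pow_succ_log_self one_lt_two N
  generalize Nat.log 2 N = ℓ at hN ⊢
  have h2 : 2 ^ (3 * k) < 2 ^ (10 * ℓ + 15) :=
    calc 2 ^ (3 * k) < 32 * N ^ 10 := h3
      _ ≤ 2 ^ 5 * (2 ^ (ℓ + 1)) ^ 10 := Nat.mul_le_mul (by norm_num) (Nat.pow_le_pow_left hN.le 10)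
      _ = 2 ^ (10 * ℓ + 15) := by rw [← pow_mul, ← pow_add]; congr 1; ring
  have h3k : 3 * k ≤ 10 * ℓ + 14 := by have := (Nat.pow_lt_pow_iff_right one_lt_two).1 h2; omega
  have hkd : 90 * (k * d) ≤ (10 * ℓ + 14) ^ 2 := by
    nlinarith [Nat.mul_le_mul h3k (show 30 * d ≤ 10 * ℓ + 14 by omega)]
  have h5 : ((s + 1) ^ 36) ^ 100 < (2 ^ ((ℓ + 2) ^ 2)) ^ 100 :=
    calc ((s + 1) ^ 36) ^ 100 = ((s + 1) ^ 40) ^ 90 := by simp only [← pow_mul]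
      _ < (2 ^ (k * d)) ^ 90 := Nat.pow_lt_pow_left h40 (by norm_num)
      _ = 2 ^ (90 * (k * d)) := by rw [← pow_mul, Nat.mul_comm (k * d) 90]
      _ ≤ 2 ^ ((10 * ℓ + 14) ^ 2) := Nat.pow_le_pow_right two_pos hkd
      _ ≤ 2 ^ ((10 * ℓ + 20) ^ 2) := Nat.pow_le_pow_right two_pos (Nat.pow_le_pow_left (by omega) 2)
      _ = (2 ^ ((ℓ + 2) ^ 2)) ^ 100 := by rw [← pow_mul]; congr 1; ring
  exact lt_of_pow_lt_pow_left₀ 100 (Nat.zero_le _) h5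

/-- **The cap through one projection** `A`, any `Δ ≥ 1`, block map, word, field. [cite: LimayeSrinivasanTavenas2025, Lemma 15] -/
theorem not_lstCertifies_projection {σ₀ : Type} [Fintype σ₀] (F : MvPolynomial σ₀ K) {τ : Type} [Fintype τ]
    {d : ℕ} (blk : τ → Fin d) (A : σ₀ → τ ⊕ K) {s Δ : ℕ} (hΔ : 1 ≤ Δ)
    (hs : 2 ^ ((Nat.log 2 (Fintype.card σ₀) + 2) ^ 2) ≤ (s + 1) ^ 36) :
    ¬ LSTCertifies blk (aeval (ArithCircuit.substVCFun A) F) s Δ := by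
  intro h
  have hd := one_le_of_lstCertifies h
  obtain ⟨k, pos, g, hk, hg, hlt⟩ := h
  have hcap : relRank K pos Finset.univ (aeval g (aeval (ArithCircuit.substVCFun A) F)) ≤
      (Fintype.card σ₀ : ℝ) ^ d * (2 : ℝ) ^ (-((∑ b : Fin d, letterSize k pos b : ℕ) : ℝ) / 2) :=
    (relRank_aeval_le_pow hg _).trans (mul_le_mul_of_nonneg_right
      (pow_le_pow_left₀ (Nat.cast_nonneg _) (by exact_mod_cast card_vars_aeval_substVCFun_le A F) d) (by positivity))
  have h3 : 2 ^ (3 * k) < 32 * Fintype.card σ₀ ^ 10 := by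
    by_contra hcon
    have hΛΦ : Phi k Δ d ≤ Lam s (Fintype.card τ) d Δ * Phi k Δ d :=
      le_mul_of_one_le_left (Phi_pos _ _ _).le (one_le_Lam _ _ _ _)
    exact (not_lt.2 ((hcap.trans (pow_mul_two_pow_le_Phi pos hd (not_lt.1 hcon) Δ)).trans hΛΦ)) hlt
  exact (not_lt.2 hs) (cap_arith hk h3 (pow_lt_two_pow_of_lt hd hΔ (relRank_le_one pos _ _) hlt))

/-- **THE TRANSPORTED LST PIPELINE IS QUASI-POLYNOMIALLY CAPPED**: every `N`-variate `F`, `Δ ≥ 1`, `(s+1)^{36} ≥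
2^{(⌊log₂N⌋+2)^2}` ⇒ `¬ TLSTCertifies F s Δ`, whatever projection / blocks / word / field. [cite: LimayeSrinivasanTavenas2025, Lemma 15] -/
theorem not_tlstCertifies {σ₀ : Type} [Fintype σ₀] (F : MvPolynomial σ₀ K) {s Δ : ℕ} (hΔ : 1 ≤ Δ)
    (hs : 2 ^ ((Nat.log 2 (Fintype.card σ₀) + 2) ^ 2) ≤ (s + 1) ^ 36) : ¬ TLSTCertifies F s Δ :=
  fun ⟨_, _, blk, A, h⟩ => not_lstCertifies_projection F blk A hΔ hs h

/-- The direct class obeys the same cap (identity projection). [cite: LimayeSrinivasanTavenas2025, Lemma 15] -/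
theorem not_lstCertifies_of_le {σ₀ : Type} [Fintype σ₀] {d : ℕ} (blk₀ : σ₀ → Fin d) (F : MvPolynomial σ₀ K)
    {s Δ : ℕ} (hΔ : 1 ≤ Δ) (hs : 2 ^ ((Nat.log 2 (Fintype.card σ₀) + 2) ^ 2) ≤ (s + 1) ^ 36) :
    ¬ LSTCertifies blk₀ F s Δ :=
  fun h => not_tlstCertifies F hΔ hs (tlstCertifies_of_lstCertifies h)

/-- Door arithmetic: `2^{(⌊log₂(m²)⌋+2)^2} ≤ ((m+2)^{⌊√m⌋+1})^{36}` (`2^ℓ ≤ (m+2)^2`, `ℓ ≤ 4⌊√m⌋+3`). [folklore] -/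
theorem door_arith (m : ℕ) : 2 ^ ((Nat.log 2 (m * m) + 2) ^ 2) ≤ ((m + 2) ^ (Nat.sqrt m + 1)) ^ 36 := by
  have h1 : 2 ^ Nat.log 2 (m * m) ≤ (m + 2) ^ 2 := (Nat.pow_log_le_add_one 2 _).trans (by nlinarith)
  have h4 : m * m < 2 ^ (4 * Nat.sqrt m + 4) :=
    calc m * m < (Nat.sqrt m + 1) ^ 2 * (Nat.sqrt m + 1) ^ 2 := Nat.mul_self_lt_mul_self (Nat.lt_succ_sqrt' m)
      _ = (Nat.sqrt m + 1) ^ 4 := by ring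
      _ ≤ (2 ^ (Nat.sqrt m + 1)) ^ 4 := Nat.pow_le_pow_left (Nat.lt_two_pow_self (n := Nat.sqrt m + 1)).le 4
      _ = 2 ^ (4 * Nat.sqrt m + 4) := by rw [← pow_mul]; congr 1; omega
  have h2 := Nat.log_lt_of_lt_pow' (by omega : 4 * Nat.sqrt m + 4 ≠ 0) h4
  generalize Nat.log 2 (m * m) = ℓ at h1 h2 ⊢
  generalize Nat.sqrt m = t at h2 ⊢
  calc 2 ^ ((ℓ + 2) ^ 2) = (2 ^ ℓ) ^ (ℓ + 4) * 2 ^ 4 := by rw [← pow_mul, ← pow_add]; congr 1; ring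
    _ ≤ ((m + 2) ^ 2) ^ (ℓ + 4) * (m + 2) ^ 4 :=
        Nat.mul_le_mul (Nat.pow_le_pow_left h1 _) (Nat.pow_le_pow_left (by omega) 4)
    _ = (m + 2) ^ (2 * ℓ + 12) := by rw [← pow_mul, ← pow_add, show 2 * (ℓ + 4) + 4 = 2 * ℓ + 12 by omega]
    _ ≤ (m + 2) ^ (36 * (t + 1)) := Nat.pow_le_pow_right (by omega) (by omega)
    _ = ((m + 2) ^ (t + 1)) ^ 36 := by rw [← pow_mul, Nat.mul_comm 36 (t + 1)]

/-- **No depth-4 chasm door** `(m+2)^{c⌊√m⌋+c}`, `c ≥ 1`, for any `m × m`-variate target. [cite: LimayeSrinivasanTavenas2025, Lemma 15] -/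
theorem not_tlstCertifies_of_door {m : ℕ} (F : MvPolynomial (Fin m × Fin m) K) (c : ℕ) (hc : 1 ≤ c) {s Δ : ℕ}
    (hΔ : 1 ≤ Δ) (hs : (m + 2) ^ (c * Nat.sqrt m + c) ≤ s + 1) : ¬ TLSTCertifies F s Δ :=
  not_tlstCertifies F hΔ (by
    rw [Fintype.card_prod, Fintype.card_fin]
    exact (door_arith m).trans ((Nat.pow_le_pow_left (Nat.pow_le_pow_right (by omega)
      (Nat.add_le_add (Nat.le_mul_of_pos_left _ hc) hc)) 36).trans (Nat.pow_le_pow_left hs 36)))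

/-- **The transported LST pipeline reaches no depth-4 chasm door for `per_m`** (`c ≥ 1`, `Δ ≥ 1`, any field).
[cite: LimayeSrinivasanTavenas2025, Lemma 15] -/
theorem not_tlstCertifies_perPoly (m c : ℕ) (hc : 1 ≤ c) {s Δ : ℕ} (hΔ : 1 ≤ Δ)
    (hs : (m + 2) ^ (c * Nat.sqrt m + c) ≤ s + 1) : ¬ TLSTCertifies (perPoly (Fin m) K) s Δ :=
  not_tlstCertifies_of_door _ c hc hΔ hs

/-- The same for the determinant. [cite: LimayeSrinivasanTavenas2025, Lemma 15] -/
theorem not_tlstCertifies_detPoly (m c : ℕ) (hc : 1 ≤ c) {s Δ : ℕ} (hΔ : 1 ≤ Δ)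
    (hs : (m + 2) ^ (c * Nat.sqrt m + c) ≤ s + 1) : ¬ TLSTCertifies (detPoly (Fin m) K) s Δ :=
  not_tlstCertifies_of_door _ c hc hΔ hs

end
end Summit.ValiantsHypothesis.ValiantsHypothesis.Theorems.LSTTransportCap
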